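import Literature.AlgebraicGeometry.HodgeTheory.FermatEigenspaceNonvanishingOdd
import Literature.AlgebraicGeometry.HodgeTheory.DiagonalElementEigenspaces
import Literature.AlgebraicGeometry.HodgeTheory.SmoothHypersurfaceMiddleBettiNumber
import HarnessLib

/-!
# The middle Betti number of the odd-dimensional Fermat variety and of every smooth odd-dimensional hypersurface:
# `b₂ₚ₊₁(X²ᵖ⁺¹ₘ) = |𝔄²ᵖ⁺¹ₘ|`, `b₂ₚ₊₁(X_F) = |𝔄²ᵖ⁺¹_d|`; `b₃` of a smooth threefold in `ℙ⁴` (Shioda 1979 §1 (1.3)–(1.4); Eisenbud–Harris Ex. 5.24)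

Family `hodge`, layer `Literature/AlgebraicGeometry/HodgeTheory`. PROOF FILE (theorems only: no definition, no named
fact, no instance; D-0026 net debt `0`). T. Shioda, *The Hodge conjecture for Fermat varieties*, Math. Ann. 245
(1979), §1 (1.3)–(1.4): "`Hⁿ_prim(Xⁿₘ, ℂ) = ⊕_{α ∈ 𝔄ⁿₘ} V(α)`, `dim V(α) = 1`". For ODD `n = 2p + 1` the primitive
cohomology is all of `Hⁿ` (there is no ambient class in odd degree), so `bₙ(Xⁿₘ) = |𝔄ⁿₘ|`; and since the Betti
numbers of smooth hypersurfaces are constant in the universal family (Ehresmann; the tree's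
`finrank_bettiCohomology_hypersurface_eq_of_isNonsingularForm`), `b₂ₚ₊₁(X_F) = |𝔄²ᵖ⁺¹_d|` for every nonsingular form
`F` of degree `d` in `2p + 3` variables — D. Eisenbud, J. Harris, *3264 and All That* (2016), Example 5.24 ("the
Euler characteristic determines the middle Betti number `b_{n−1}`"), in Shioda's closed form. Everything is ASSEMBLED
from tree theorems: the character decomposition (`isInternal_fermatEigenspace`), multiplicity one
(`fermatEigenspace_le_span_odd`), vanishing off `𝔄` (`fermatEigenspace_eq_bot_odd_of_apply_eq_zero`,
`fermatEigenspace_eq_bot_of_sum_ne_zero`) and the odd-dimensional existence half `fermatEigenspace_ne_bot_odd`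
(companion file `FermatEigenspaceNonvanishingOdd`).

* `finrank_fermatEigenspace_odd_eq_one`, `finrank_fermatEigenspace_odd_eq_zero_of_not` — `dim V(α) ∈ {1, 0}`.
* `finrank_iSup_fermatEigenspace_odd_eq_card` — `dim ⨆_{α ∈ A} V(α) = #(A ∩ 𝔄)` for any set `A` of characters
  (the form in which eigenspaces of single group elements are counted).
* `finrank_eigenspace_diagonalPullback_fermat_odd_eq_card` — for ONE `a ∈ μₘ²ᵖ⁺³` and `μ ∈ ℂ`:
  `dim ker (g_a^* − μ) = #{α ∈ 𝔄²ᵖ⁺¹ₘ : χ_α(a) = μ}` on `H²ᵖ⁺¹(X²ᵖ⁺¹ₘ(ℂ); ℂ)` (with `DiagonalElementEigenspaces`).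
* **`finrank_complexBetti_fermat_odd_eq_card`**, `finrank_bettiCohomology_fermat_odd_eq_card` —
  `b₂ₚ₊₁(X²ᵖ⁺¹ₘ) = |𝔄²ᵖ⁺¹ₘ|` over `ℂ` and over `ℚ` (`p, m ≥ 1`; equality in the tree's
  `finrank_complexBetti_fermat_odd_le`).
* **`finrank_bettiCohomology_middle_hypersurface_odd`** — `b₂ₚ₊₁(X_F) = |𝔄²ᵖ⁺¹_d|` for every nonsingular `F` of
  degree `d ≥ 1` in `2p + 3` variables, `p ≥ 1` (equality in the tree's `finrank_bettiCohomology_middle_hypersurface_odd_le`).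
* `card_fermatAdmissible_five_add`, **`finrank_bettiCohomology_three_hypersurface_add`** — `|𝔄³ₘ| = (m−1)⁴ − (m−1)³ +
  (m−1)² − (m−1)` and `b₃` of a smooth threefold of degree `d` in `ℙ⁴` (quartic `60`, quintic `204`).
-- TODO(general form): `p = 0` (plane curves: `b₁ = (d−1)(d−2)` is the tree's `finrank_bettiCohomology_one_planeCurve'`).

Written by the prover seat `hodge-nonav-19716-p2` (g5, cell `hodge-nonav`) as step F1 of the discharge, modulo the
geometric genus, of the binder hV of crux K1-B `VeryGeneralSignCommutatorsInHg` (route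
`HodgeConjecture/SignSymmetricPowers`).

## References

* [Shioda1979HodgeFermat] T. Shioda, The Hodge conjecture for Fermat varieties, Math. Ann. 245 (1979) 175–184, §1 (1.3)–(1.4).
* [Ran1980] Z. Ran, Cycles on Fermat hypersurfaces, Compositio Math. 42 (1980) 121–142, §1 Prop. 1.7 (i).
* [EisenbudHarris2016] D. Eisenbud, J. Harris, 3264 and All That, CUP 2016, §5.7 Example 5.24 and Table 5.1.
* [HatcherAT2002] A. Hatcher, Algebraic Topology, CUP 2002, §3.1 Thm. 3.2 (universal coefficients over a field).
* [Katz2009] N. M. Katz, Another look at the Dwork family, Progr. Math. 269 (2009), §3.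
-/

noncomputable section

open CategoryTheory CategoryTheory.Limits AlgebraicGeometry

namespace Literature.AlgebraicGeometry.HodgeTheory

open Literature.AlgebraicGeometry.Motives Literature.AlgebraicTopology.SingularHomology

variable {m : ℕ}

/-! ### Dimensions of the character spaces of `H²ᵖ⁺¹(X²ᵖ⁺¹ₘ(ℂ); ℂ)` -/

/-- **`dim V(α) = 1` for an admissible character of the odd-dimensional Fermat variety** (`p, m ≥ 1`): at most a
line (`fermatEigenspace_le_span_odd`), non-zero by `fermatEigenspace_ne_bot_odd`.
[cite: Shioda1979HodgeFermat, §1 (1.3)–(1.4)] [cite: Ran1980, §1 Prop. 1.7 (i)] -/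
theorem finrank_fermatEigenspace_odd_eq_one [NeZero m] {p : ℕ} (hp : 1 ≤ p) {α : Fin (2 * p + 3) → ZMod m}
    (hα : ∀ i, α i ≠ 0) (hαs : ∑ i, α i = 0) :
    Module.finrank ℂ ↥(fermatEigenspace m α (2 * p + 1)) = 1 := by
  have hm1 : 1 ≤ m := NeZero.one_le
  have hX : IsSmoothProjective (2 * p + 1) (fermatHypersurface (2 * p + 1) m) :=
    isSmoothProjective_fermatHypersurface (by omega) hm1
  haveI := finite_complexBetti hX (2 * p + 1)
  obtain ⟨v, hv⟩ := fermatEigenspace_le_span_odd hm1 p α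
  refine le_antisymm ?_ ?_
  · calc Module.finrank ℂ ↥(fermatEigenspace m α (2 * p + 1))
        ≤ Module.finrank ℂ ↥(ℂ ∙ v) := Submodule.finrank_mono hv
      _ ≤ ({v} : Set (complexBetti (fermatHypersurface (2 * p + 1) m) (2 * p + 1))).toFinset.card :=
          finrank_span_le_card _
      _ = 1 := by simp
  · rw [Nat.one_le_iff_ne_zero, Ne, Submodule.finrank_eq_zero]
    exact fermatEigenspace_ne_bot_odd hp hα hαs

/-- **`V(α) = 0` off `𝔄²ᵖ⁺¹ₘ`** (including `α = 0`: in odd degree there is no ambient class): if some `αᵢ = 0` or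
`Σ αᵢ ≠ 0` then `dim V(α) = 0` in `H²ᵖ⁺¹(X²ᵖ⁺¹ₘ(ℂ); ℂ)` (`m ≥ 1`). [cite: Shioda1979HodgeFermat, §1 (1.3)–(1.4)] -/
theorem finrank_fermatEigenspace_odd_eq_zero_of_not (hm : 1 ≤ m) (p : ℕ) {α : Fin (2 * p + 3) → ZMod m}
    (hα : ¬ ((∀ i, α i ≠ 0) ∧ ∑ i, α i = 0)) :
    Module.finrank ℂ ↥(fermatEigenspace m α (2 * p + 1)) = 0 := by
  haveI : NeZero m := ⟨by omega⟩
  have hbot : fermatEigenspace m α (2 * p + 1) = ⊥ := by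
    rw [not_and_or] at hα
    rcases hα with h1 | h2
    · push Not at h1
      obtain ⟨i, hi⟩ := h1
      exact fermatEigenspace_eq_bot_odd_of_apply_eq_zero hm p hi
    · exact fermatEigenspace_eq_bot_of_sum_ne_zero h2 _
  rw [hbot, finrank_bot]

/-- `dim (⨆ᵢ Aᵢ) = Σᵢ dim Aᵢ` for an independent finite family of subspaces (through `⨁ᵢ Aᵢ ≃ ⨆ᵢ Aᵢ`; plumbing).
[folklore] -/
private theorem finrank_iSup_eq_sum_of_iSupIndep' {K M : Type*} [Field K] [AddCommGroup M] [Module K M]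
    {ι : Type*} [Fintype ι] (B : ι → Submodule K M) (hB : iSupIndep B) [∀ i, Module.Finite K (B i)] :
    Module.finrank K ↥(⨆ i, B i) = ∑ i, Module.finrank K (B i) := by
  classical
  have hinj := hB.dfinsupp_lsum_injective
  have hrange : LinearMap.range (DFinsupp.lsum ℕ (M := fun i => ↥(B i)) fun i => (B i).subtype) = ⨆ i, B i :=
    (Submodule.iSup_eq_range_dfinsupp_lsum B).symm
  rw [← hrange, LinearMap.finrank_range_of_inj hinj, ← Module.finrank_directSum]
  rfl

/-- **`dim (⨆_{α ∈ A} V(α)) = #(A ∩ 𝔄²ᵖ⁺¹ₘ)` for any set `A` of characters** of the odd-dimensional Fermat variety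
(`p, m ≥ 1`): the `V(α)` are independent (`iSupIndep_fermatEigenspace`), of dimension `1` on `𝔄` and `0` elsewhere.
This is the form in which eigenspaces of single group elements (unions of character spaces) are counted.
[cite: Shioda1979HodgeFermat, §1 (1.3)–(1.4)] -/
theorem finrank_iSup_fermatEigenspace_odd_eq_card [NeZero m] {p : ℕ} (hp : 1 ≤ p)
    (A : Set (Fin (2 * p + 3) → ZMod m)) [DecidablePred (· ∈ A)] :
    Module.finrank ℂ ↥(⨆ α : A, fermatEigenspace m α.1 (2 * p + 1)) =
      Fintype.card {α : Fin (2 * p + 3) → ZMod m // α ∈ A ∧ (∀ i, α i ≠ 0) ∧ ∑ i, α i = 0} := by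
  classical
  have hm : 1 ≤ m := NeZero.one_le
  have hX : IsSmoothProjective (2 * p + 1) (fermatHypersurface (2 * p + 1) m) :=
    isSmoothProjective_fermatHypersurface (by omega) hm
  haveI := finite_complexBetti hX (2 * p + 1)
  have hind : iSupIndep fun α : A ↦ fermatEigenspace m α.1 (2 * p + 1) :=
    (iSupIndep_fermatEigenspace (n := 2 * p + 1) (m := m) (2 * p + 1)).comp Subtype.val_injective
  have hdim : ∀ α : Fin (2 * p + 3) → ZMod m, Module.finrank ℂ ↥(fermatEigenspace m α (2 * p + 1)) =
      if (∀ i, α i ≠ 0) ∧ ∑ i, α i = 0 then 1 else 0 := by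
    intro α
    split_ifs with hgood
    · exact finrank_fermatEigenspace_odd_eq_one hp hgood.1 hgood.2
    · exact finrank_fermatEigenspace_odd_eq_zero_of_not hm p hgood
  rw [finrank_iSup_eq_sum_of_iSupIndep' _ hind]
  simp_rw [hdim]
  rw [Finset.sum_boole, ← Fintype.card_subtype]
  exact Fintype.card_congr (Equiv.subtypeSubtypeEquivSubtypeInter (fun α : Fin (2 * p + 3) → ZMod m ↦ α ∈ A)
    (fun α ↦ (∀ i, α i ≠ 0) ∧ ∑ i, α i = 0))

/-- **Eigenspaces of ONE element of `μₘ²ᵖ⁺³` on `H²ᵖ⁺¹(X²ᵖ⁺¹ₘ(ℂ); ℂ)`**: for `a ∈ μₘ²ᵖ⁺³` and `μ ∈ ℂ`,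
`dim ker (g_a^* − μ) = #{α ∈ 𝔄²ᵖ⁺¹ₘ : χ_α(a) = μ}` (`p, m ≥ 1`) — the eigenspace is `⊕ {V(α) : χ_α(a) = μ}`
(`eigenspace_diagonalPullback_fermat_eq_iSup`) and each admissible `V(α)` is a line. This is how the `±1`-eigenspaces
of the sign involution of the Fermat threefold are counted. [cite: Shioda1979HodgeFermat, §1 (1.3)–(1.4)] [cite: Katz2009, §3] -/
theorem finrank_eigenspace_diagonalPullback_fermat_odd_eq_card [NeZero m] {p : ℕ} (hp : 1 ≤ p)
    (a : fermatGroup (2 * p + 1) m) (μ : ℂ) :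
    Module.finrank ℂ ↥(Module.End.eigenspace
        (diagonalPullback (fermatPolynomial ℂ (2 * p + 1) m) (fermatGroup_le_diagonalStabilizer m a.2) (2 * p + 1)) μ) =
      Fintype.card {α : Fin (2 * p + 3) → ZMod m //
        ((fermatCharacter m α a : ℂˣ) : ℂ) = μ ∧ (∀ i, α i ≠ 0) ∧ ∑ i, α i = 0} := by
  classical
  rw [eigenspace_diagonalPullback_fermat_eq_iSup]
  exact finrank_iSup_fermatEigenspace_odd_eq_card hp {α | ((fermatCharacter m α a : ℂˣ) : ℂ) = μ}

/-- **The middle Betti number of the odd-dimensional Fermat variety: `b₂ₚ₊₁(X²ᵖ⁺¹ₘ) = |𝔄²ᵖ⁺¹ₘ|`** (`p, m ≥ 1`; over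
`ℂ`), `𝔄²ᵖ⁺¹ₘ = {α ∈ (ℤ/m ∖ 0)^{2p+3} : Σ αᵢ = 0}`: the character decomposition `H²ᵖ⁺¹ = ⊕_α V(α)` with
`dim V(α) = 1` on `𝔄` and `0` elsewhere. Equality in the tree's `finrank_complexBetti_fermat_odd_le`.
[cite: Shioda1979HodgeFermat, §1 (1.3)–(1.4)] [cite: Ran1980, §1 Prop. 1.7 (i)] -/
theorem finrank_complexBetti_fermat_odd_eq_card [NeZero m] {p : ℕ} (hp : 1 ≤ p) :
    Module.finrank ℂ (complexBetti (fermatHypersurface (2 * p + 1) m) (2 * p + 1)) =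
      Fintype.card {α : Fin (2 * p + 3) → ZMod m // (∀ i, α i ≠ 0) ∧ ∑ i, α i = 0} := by
  classical
  have h := finrank_iSup_fermatEigenspace_odd_eq_card (m := m) hp Set.univ
  have htop : (⨆ α : (Set.univ : Set (Fin (2 * p + 3) → ZMod m)), fermatEigenspace m α.1 (2 * p + 1)) = ⊤ := by
    rw [← iSup_fermatEigenspace_eq_top (n := 2 * p + 1) (m := m) (2 * p + 1)]
    exact ((Equiv.Set.univ (Fin (2 * p + 3) → ZMod m)).symm.iSup_congr fun _ ↦ rfl).symm
  rw [htop, finrank_top] at h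
  rw [h]
  exact Fintype.card_congr (Equiv.subtypeEquivRight fun α ↦ by simp)

/-- **`b₂ₚ₊₁(X²ᵖ⁺¹ₘ) = |𝔄²ᵖ⁺¹ₘ|` over `ℚ`** (`p, m ≥ 1`; universal coefficients). [cite: Shioda1979HodgeFermat, §1 (1.3)–(1.4)] -/
theorem finrank_bettiCohomology_fermat_odd_eq_card [NeZero m] {p : ℕ} (hp : 1 ≤ p) :
    Module.finrank ℚ (bettiCohomology (fermatHypersurface (2 * p + 1) m) (2 * p + 1)) =
      Fintype.card {α : Fin (2 * p + 3) → ZMod m // (∀ i, α i ≠ 0) ∧ ∑ i, α i = 0} := by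
  rw [← finrank_complexBetti_fermat_odd_eq_card hp]
  change Module.finrank ℚ (singularCohomology ℚ ℚ (ComplexPoints (fermatHypersurface (2 * p + 1) m)) (2 * p + 1)) =
    Module.finrank ℂ (singularCohomology ℂ ℂ (ComplexPoints (fermatHypersurface (2 * p + 1) m)) (2 * p + 1))
  rw [finrank_singularCohomology_eq_bettiNumber_of_field, finrank_singularCohomology_eq_bettiNumber_of_field,
    bettiNumber_eq_of_algebra ℚ ℂ]

/-! ### Every smooth odd-dimensional hypersurface -/

/-- **The middle Betti number of a smooth ODD-dimensional hypersurface: `b₂ₚ₊₁(X_F) = |𝔄²ᵖ⁺¹_d|`** for a nonsingular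
form `F` of degree `d ≥ 1` in `2p + 3` variables (`p ≥ 1`): `b₂ₚ₊₁` is constant over the universal family of smooth
hypersurfaces (Ehresmann, `finrank_bettiCohomology_hypersurface_eq_of_isNonsingularForm`) and this is its value at the
Fermat variety `X²ᵖ⁺¹_d`. Eisenbud–Harris's "the Euler characteristic determines the middle Betti number" in Shioda's
closed form; equality in the tree's `finrank_bettiCohomology_middle_hypersurface_odd_le`.
[cite: EisenbudHarris2016, Example 5.24] [cite: Shioda1979HodgeFermat, §1 (1.3)–(1.4)] -/
theorem finrank_bettiCohomology_middle_hypersurface_odd {d : ℕ} [NeZero d] {p : ℕ} (hp : 1 ≤ p)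
    (F : MvPolynomial (Fin (2 * p + 1 + 2)) ℂ) (hF : F.IsHomogeneous d)
    (hFns : SmoothHypersurface.IsNonsingularForm ℂ F) :
    Module.finrank ℚ (bettiCohomology (SmoothHypersurface.hypersurface F) (2 * p + 1)) =
      Fintype.card {α : Fin (2 * p + 3) → ZMod d // (∀ i, α i ≠ 0) ∧ ∑ i, α i = 0} := by
  have hd : 1 ≤ d := NeZero.one_le
  have hfermat : SmoothHypersurface.IsNonsingularForm ℂ (fermatPolynomial ℂ (2 * p + 1) d) :=
    SmoothHypersurface.isNonsingularForm_sum_X_pow (Nat.cast_ne_zero.mpr (NeZero.ne d))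
  rw [finrank_bettiCohomology_hypersurface_eq_of_isNonsingularForm (n := 2 * p + 1) hd hF hFns
    (isHomogeneous_fermatPolynomial (2 * p + 1) d) hfermat (2 * p + 1)]
  exact finrank_bettiCohomology_fermat_odd_eq_card hp

/-- **The count `N₅ = |𝔄³ₘ|`**: `N₅ + (m−1)³ + (m−1) = (m−1)⁴ + (m−1)²`, i.e. `N₅ = (m−1)⁴ − (m−1)³ + (m−1)² − (m−1)`
(from `N_{k+1} + N_k = (m−1)^k`). [cite: Shioda1979HodgeFermat, §1 (1.3)–(1.4)] -/
theorem card_fermatAdmissible_five_add [NeZero m] :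
    Fintype.card {α : Fin 5 → ZMod m // (∀ i, α i ≠ 0) ∧ ∑ i, α i = 0} + (m - 1) ^ 3 + (m - 1) =
      (m - 1) ^ 4 + (m - 1) ^ 2 := by
  have h4 := card_fermatAdmissible_four_add m
  have h5 : Fintype.card {α : Fin 5 → ZMod m // (∀ i, α i ≠ 0) ∧ ∑ i, α i = 0} +
      Fintype.card {α : Fin 4 → ZMod m // (∀ i, α i ≠ 0) ∧ ∑ i, α i = 0} = (m - 1) ^ 4 :=
    card_fermatAdmissible_succ_add m 4
  omega

/-- **`b₃` of a smooth threefold of degree `d` in `ℙ⁴`**: for a nonsingular quinary form `F` of degree `d ≥ 1`,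
`b₃(X_F) + (d−1)³ + (d−1) = (d−1)⁴ + (d−1)²`, i.e. `b₃ = (d−1)⁴ − (d−1)³ + (d−1)² − (d−1)` (quartic `60`, quintic
`204`). [cite: EisenbudHarris2016, Example 5.24] [cite: Shioda1979HodgeFermat, §1 (1.3)–(1.4)] -/
theorem finrank_bettiCohomology_three_hypersurface_add {d : ℕ} [NeZero d] (F : MvPolynomial (Fin (3 + 2)) ℂ)
    (hF : F.IsHomogeneous d) (hFns : SmoothHypersurface.IsNonsingularForm ℂ F) :
    Module.finrank ℚ (bettiCohomology (SmoothHypersurface.hypersurface F) 3) + (d - 1) ^ 3 + (d - 1) =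
      (d - 1) ^ 4 + (d - 1) ^ 2 := by
  rw [finrank_bettiCohomology_middle_hypersurface_odd (p := 1) le_rfl F hF hFns]
  exact card_fermatAdmissible_five_add

end Literature.AlgebraicGeometry.HodgeTheory

end
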